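import Summits.Ventures.PercRepro.RankLevelSetUpFiveRankFive

/-! # RankLevelSetUpFiveSeriesPair — (↑)₅ AT `12` ELEMENTS ACROSS A SERIES PAIR: THE TWO-ELEMENT RESIDUE (Θ)
(night-1 g42; dossier §54; on `RankLevelSetUpFiveRankFive`)

The base case `#E = 12` of the nullity-`5` induction (`upAt_five_of_nullity_five_of_residue`, p744998) is (↑)₅
itself, and its charging proof (§53) is obstructed exactly by the targets shared between two lines — which needs a
PARALLEL PAIR `P = cl✶ {p} = {p, p'}` of the dual `N = M✶` (a series pair of `M`). Across such a pair the sorts of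
`RankLevelSetUpFiveRankFiveSort` at `q = 2` read `T_5 = A_5 + 2 g_4` (**`through_five_eq_rank_five`**) and
`V_6 = Ā_6 + 2 ḡ_5 + ḡ_4^{sp}` (**`avoid_six_eq_rank_five_of_two`**), and `g_4 ≤ ḡ_5` is (↑)₄ of the nullity-`4`
deletion `M ＼ P` on `10` elements (**`throughHat_four_le_avoidHat_five_rank_five`**). Hence, for `b ∉ P`, (↑)₅ at
`b` follows from the TWO-ELEMENT RESIDUE **`UpFiveSeriesPairTheta N p b`** : `A_5 ≤ Ā_6 + ḡ_4^{sp}`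
(**`upAt_five_of_seriesPair_of_theta`**) — in `N ＼ p'` (`11` elements) it reads «the co-spanning bases through `b`
avoiding `p` are at most the co-spanning bases through `p`» (a `Prop`, NOT asserted; census: 0 failures on the
`7`-element catalogue (loopless, every ordered pair), 0 / 26,620 random rank-`5` instances on `11` elements, tight in
12 % of them). For `b ∈ P` (↑)₅ is UNCONDITIONAL (**`upAt_five_of_mem_seriesPair`**): `T_5 ≤ 𝒢_4 ≤ 𝒢_5 ≤ V_6`
by the injection `W ↦ W ∖ P`, Mono's step `4` of `M ＼ P` and the `s = 1` piece of `avoid_six_ge_of_mem`. Every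
declaration has a docstring; imports: the cell's own modules and Mathlib only. Axioms: standard. -/

namespace PercRepro

open Set Matroid

variable {α : Type}

/-! ## The two-element residue (Θ) -/

/-- **THE TWO-ELEMENT RESIDUE (Θ) OF (↑)₅ ACROSS A PARALLEL PAIR OF THE DUAL** (night-1 g42; a `Prop`, NOT
asserted): `A_5 ≤ Ā_6 + ḡ_4^{sp}` — the through-`b` members of the mixed family at level `5` (`upFull`: `5`-sets
`W ⊆ E ∖ cl {p}` through `b` spanning `N` whose complement spans `N` with `p`) are at most the `6`-sets `Z ⊆ E ∖ cl {p}`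
spanning `N` whose complement spans `N` with `p`, sorted by `b ∉ Z` (`avoidFull`) and `b ∈ Z` (`avoidSp`, written
by its complement `D = (E ∖ cl {p}) ∖ Z`). In `N ＼ p'` (`11` elements) this is «#{co-spanning bases ∋ b, ∌ p} ≤
#{co-spanning bases ∋ p}». Census: 0 failures on every loopless rank-`3` matroid on `7` elements and 0 / 26,620 random
rank-`5` instances on `11` elements (night-1 g42, work/theta11.py, thetacat.py), tight in 12 % of them. -/
def UpFiveSeriesPairTheta (N : Matroid α) (p b : α) : Prop :=
  (upFull N p b 5).ncard ≤ (avoidFull N p b 6).ncard + (avoidSp N p b 4).ncard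

variable (M : Matroid α) [M.Finite]

/-- **The deletion of a series pair has `#E − 2` elements.** -/
lemma ncard_sdiff_seriesPair {p : α} (hq : (M✶.closure {p}).ncard = 2) :
    (M.E \ M✶.closure {p}).ncard = M.E.ncard - 2 := by
  have hPE : M✶.closure {p} ⊆ M.E := by
    have := M✶.closure_subset_ground {p}
    rwa [Matroid.dual_ground] at this
  rw [Set.ncard_sdiff' hPE M.ground_finite, hq]

/-- **(↑) AT LEVEL `5` OUTSIDE A SERIES PAIR ON NULLITY `5` WITH `12` ELEMENTS, FROM THE TWO-ELEMENT RESIDUE**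
(`M` coloop-free of nullity `5`, `12 ≤ #E`, `P = cl✶ {p}` of size `2`, `b ∉ P`): the sorts `T_5 = A_5 + 2 g_4`
and `V_6 = Ā_6 + 2 ḡ_5 + ḡ_4^{sp}`, `g_4 ≤ ḡ_5` ((↑)₄ of `M ＼ P`, `#(E ∖ P) ≥ 10`) and (Θ) give
`T_5 ≤ Ā_6 + ḡ_4^{sp} + 2 ḡ_5 = V_6`. -/
theorem upAt_five_of_seriesPair_of_theta (hcol : ∀ e, ¬ M.IsColoop e) (hν : M✶.eRank = 5) {p : α}
    (hp : p ∈ M.E) (hq : (M✶.closure {p}).ncard = 2) {b : α} (hb : b ∈ M.E) (hbP : b ∉ M✶.closure {p})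
    (hn : 12 ≤ M.E.ncard) (hθ : UpFiveSeriesPairTheta M✶ p b) : BiIndepUpAt M b 5 := by
  have hnl := dual_isNonloop_of_coloopFree' M hcol
  have hpE : p ∈ M✶.E := by rwa [Matroid.dual_ground]
  have h10 : 10 ≤ (M.E \ M✶.closure {p}).ncard := by
    rw [ncard_sdiff_seriesPair M hq]; omega
  have hg := throughHat_four_le_avoidHat_five_rank_five M hcol hν hp hb hbP h10
  unfold UpFiveSeriesPairTheta at hθ
  unfold BiIndepUpAt
  rw [biIndep_eq_biSpan_dual, biIndep_eq_biSpan_dual,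
    through_five_eq_rank_five M✶ hnl hν hpE (by omega) hbP, avoid_six_eq_rank_five_of_two M✶ hnl hν hpE hq hbP, hq]
  omega

/-- **(↑) AT LEVEL `5` AT AN ELEMENT OF A SERIES PAIR ON NULLITY `5` WITH `12` ELEMENTS — UNCONDITIONAL**
(`M` coloop-free of nullity `5`, `12 ≤ #E`, `P = cl✶ {p}` of size `2`, `b ∈ P`): a bi-spanning `5`-set through `b`
meets `P` in `{b}`, so `W ↦ W ∖ P` injects `T_5` into `𝒢_4 = avoidHat M✶ p b 4 = biIndep (M ＼ P) 4`; Mono's step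
`4` of the `10`-element deletion gives `𝒢_4 ≤ 𝒢_5`, and the sets `D ∪ {p'}`, `D ∈ 𝒢_5`, are bi-spanning `6`-sets
avoiding `b` (`avoid_six_ge_of_mem` at `#(P ∖ {b}) = 1`). -/
theorem upAt_five_of_mem_seriesPair (hcol : ∀ e, ¬ M.IsColoop e) (hν : M✶.eRank = 5) {p : α}
    (hp : p ∈ M.E) (hq : (M✶.closure {p}).ncard = 2) {b : α} (hbP : b ∈ M✶.closure {p})
    (hn : 12 ≤ M.E.ncard) : BiIndepUpAt M b 5 := by
  classical
  have hnl := dual_isNonloop_of_coloopFree' M hcol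
  have hpE : p ∈ M✶.E := by rwa [Matroid.dual_ground]
  have hpnl : M✶.IsNonloop p := hnl p hpE
  have hPE : M✶.closure {p} ⊆ M✶.E := M✶.closure_subset_ground _
  have hPfin : (M✶.closure {p}).Finite := M✶.ground_finite.subset hPE
  unfold BiIndepUpAt
  rw [biIndep_eq_biSpan_dual, biIndep_eq_biSpan_dual]
  -- `T_5 ≤ 𝒢_4` by `W ↦ W ∖ P` (the injection of `upAt_five_of_mem_seriesClass_rank_five`, valid for `q ≥ 2`)
  have hT : {W ∈ biSpan M✶ 5 | b ∈ W}.ncard ≤ (avoidHat M✶ p b 4).ncard := by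
    refine Set.ncard_le_ncard_of_injOn (fun W => W \ M✶.closure {p}) ?_ ?_ (avoidHat_finite M✶ p b 4)
    · rintro W ⟨⟨hWE, hW5, hWs, hWc⟩, hbW⟩
      have hWfin : W.Finite := M✶.ground_finite.subset hWE
      have hsing : W ∩ M✶.closure {p} = {b} := by
        ext y
        constructor
        · intro hy
          by_contra hyb
          exact not_two_parallel_of_spanning_five_rank_five hnl hν hWs hW5 (p := p) hy.1 hbW
            (fun h => hyb (by rw [Set.mem_singleton_iff]; exact h)) hy.2 hbP
        · intro hy; rw [Set.mem_singleton_iff] at hy; rw [hy]; exact ⟨hbW, hbP⟩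
      have hc1 : (W ∩ M✶.closure {p}).ncard = 1 := by rw [hsing, Set.ncard_singleton]
      refine ⟨fun x hx => ⟨hWE hx.1, hx.2⟩, ?_, fun h => h.2 hbP, ?_, ?_⟩
      · have h := Set.ncard_inter_add_ncard_sdiff_eq_ncard W (M✶.closure {p}) hWfin
        omega
      · have hW' : W = (W \ M✶.closure {p}) ∪ (W ∩ M✶.closure {p}) := by rw [Set.sdiff_union_inter]
        rw [hW'] at hWs
        exact (spanning_union_iff_insert M✶ hnl hpnl Set.inter_subset_right ⟨b, hbW, hbP⟩
          (Set.sdiff_subset.trans hWE)).mp hWs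
      · rw [compl_eq_sdiff_union M✶ hPE] at hWc
        have hne : (M✶.closure {p} \ W).Nonempty := by
          by_contra hemp
          rw [Set.not_nonempty_iff_eq_empty, Set.sdiff_eq_empty] at hemp
          have : M✶.closure {p} ⊆ W ∩ M✶.closure {p} := fun y hy => ⟨hemp hy, hy⟩
          have hle := Set.ncard_le_ncard this (hWfin.subset Set.inter_subset_left)
          omega
        exact (spanning_union_iff_insert M✶ hnl hpnl Set.sdiff_subset hne
          (Set.sdiff_subset.trans Set.sdiff_subset)).mp hWc
    · rintro W ⟨⟨hWE, hW5, hWs, -⟩, hbW⟩ W' ⟨⟨hW'E, hW'5, hW's, -⟩, hbW'⟩ heq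
      simp only at heq
      have hsing : ∀ (X : Set α), X ⊆ M✶.E → X.ncard = 5 → M✶.Spanning X → b ∈ X →
          X ∩ M✶.closure {p} = {b} := by
        intro X hXE hX5 hXs hbX
        ext y
        constructor
        · intro hy
          by_contra hyb
          exact not_two_parallel_of_spanning_five_rank_five hnl hν hXs hX5 (p := p) hy.1 hbX
            (fun h => hyb (by rw [Set.mem_singleton_iff]; exact h)) hy.2 hbP
        · intro hy; rw [Set.mem_singleton_iff] at hy; rw [hy]; exact ⟨hbX, hbP⟩
      rw [← Set.inter_union_sdiff W (M✶.closure {p}), ← Set.inter_union_sdiff W' (M✶.closure {p}),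
        hsing W hWE hW5 hWs hbW, hsing W' hW'E hW'5 hW's hbW', heq]
  -- `𝒢_4 ≤ 𝒢_5`: Mono's step `4` of the deletion `M ＼ P` on `#E − 2 ≥ 10` elements
  have h45 : (avoidHat M✶ p b 4).ncard ≤ (avoidHat M✶ p b 5).ncard := by
    rw [avoidHat_eq_biIndep_delete_of_mem M hcol hp hbP 4, avoidHat_eq_biIndep_delete_of_mem M hcol hp hbP 5]
    haveI : (M.delete (M✶.closure {p})).Finite := ⟨M.ground_finite.subset Set.sdiff_subset⟩
    have h10 : 10 ≤ (M.delete (M✶.closure {p})).E.ncard := by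
      rw [Matroid.delete_ground, ncard_sdiff_seriesPair M hq]; omega
    exact biIndepCount_four_le_five (M.delete (M✶.closure {p})) h10
  -- `𝒢_5 ≤ V_6`: the `s = 1` piece of `avoid_six_ge_of_mem` with `#(P ∖ {b}) = 1`
  have hV := avoid_six_ge_of_mem M✶ hnl hpE hbP
  have h1 : (M✶.closure {p} \ {b}).ncard = 1 := by
    rw [Set.ncard_sdiff_singleton_of_mem hbP, hq]
  have hc2 : Nat.choose 1 2 = 0 := by decide
  have hc3 : Nat.choose 1 3 = 0 := by decide
  rw [h1, hc2, hc3, one_mul, zero_mul, zero_mul, add_zero, add_zero] at hV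
  show {W ∈ biSpan M✶ 5 | b ∈ W}.ncard ≤ {Z ∈ biSpan M✶ 6 | b ∉ Z}.ncard
  omega

/-- **(↑) AT LEVEL `5` ON NULLITY `5` WITH `12` ELEMENTS ACROSS A SERIES PAIR, AT EVERY ELEMENT, MODULO (Θ) AT THE
ELEMENTS OUTSIDE THE PAIR** (`M` coloop-free of nullity `5`, `12 ≤ #E`, `#cl✶ {p} = 2`). -/
theorem upAt_five_of_seriesPair (hcol : ∀ e, ¬ M.IsColoop e) (hν : M✶.eRank = 5) {p : α} (hp : p ∈ M.E)
    (hq : (M✶.closure {p}).ncard = 2) (hn : 12 ≤ M.E.ncard)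
    (hθ : ∀ b ∈ M.E, b ∉ M✶.closure {p} → UpFiveSeriesPairTheta M✶ p b) {b : α} (hb : b ∈ M.E) :
    BiIndepUpAt M b 5 := by
  by_cases hbP : b ∈ M✶.closure {p}
  · exact upAt_five_of_mem_seriesPair M hcol hν hp hq hbP hn
  · exact upAt_five_of_seriesPair_of_theta M hcol hν hp hq hb hbP hn (hθ b hb hbP)

end PercRepro
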